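import Summits.HodgeConjecture.HodgeConjecture.Theorems.F0P2pK1wLetterOfN1                        -- ★ p832032 (F4c): `cmPrincipalSeries_isConstituentOf_weylConj_of_N1 (hN1)`
import Summits.HodgeConjecture.HodgeConjecture.Theorems.F0P3U3PrincipalSeriesJacquetFiltrationHolds  -- ★ N1 assembly `U3PrincipalSeriesJacquetFiltration_holds_of_lineAction (L) (hT)` (ED. 2) ∕ `…_holds (L)` (ED. 3, p832625)
import Summits.HodgeConjecture.HodgeConjecture.Theorems.F0P3U3PrincipalSeriesOpenCellTorusChar          -- ★ p831847 (γ-W): `torus_normalizedJacquet_openCellLine_eq_weylChar (L)`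
import Summits.HodgeConjecture.HodgeConjecture.Theorems.F0P2oK1wOfWeylConj                          -- ★ p826576: the K1w consumer `stubK1w_of_weylConj (hW)`
import HarnessLib

/-!
# Crux `H413`, programme P2, pay-down line `F0_P2GR91NJacquet`, K1 sub-line — stub K1w «WEYL SYMMETRY» HYPOTHESIS-FREE

Cell hodgecm-mathlib (D-0151), FLOOR 0, crux item H413 = stmt-HodgeConjecture-24833; K1 sub-line
`Cruxes/H413/Lines/F0_P2GR91NJacquetK1.lean` (registered v2 58d7bd08daa5; tree edition v3c), registered stub
`stub_K1w : StubK1wWeylSymmetric := F0P2oK1wOfWeylConj.stubK1w_of_weylConj stub_K1w_letter` with the print letter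
`stub_K1w_letter : Rogawski1990.cmPrincipalSeries_isConstituentOf_weylConj` (booked row #98, «`i_G(χ)` and `i_G(wχ)` have the same
constituents» for `U(Φ₃)(L⁺_v)` at a non-split place, [Rogawski1990, §12.2 p. 174]).

THIS FILE removes the last hypothesis from the K1w branch.  The letter #98 was derived from the ONE booked letter N1
★ `UnitaryGroup.U3PrincipalSeriesJacquetFiltration L` ([Casselman1995, Lemma 7.1.1 (a)] for `U(3)`) by ★
`F0P2pK1wLetterOfN1.cmPrincipalSeries_isConstituentOf_weylConj_of_N1 (hN1)` (p832032), and N1 is now a THEOREM of the tree,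
hypothesis-free: ★ `F0P3U3PrincipalSeriesJacquetFiltrationHolds.U3PrincipalSeriesJacquetFiltration_holds (L)` (p832625; closed cell,
open-cell bound, the two lower bounds, rank–nullity, and the `wχ`-action (γ-W) ★ p831847 on the open-cell line; used here through
its one-step unfolding `…_holds_of_lineAction L (…torus_normalizedJacquet_openCellLine_eq_weylChar L)`).  Composing the two:

* §1 **`cmPrincipalSeries_isConstituentOf_weylConj_holds : Rogawski1990.cmPrincipalSeries_isConstituentOf_weylConj`** — the K1w
  LETTER #98 as a theorem of the tree (no binder); one-token fold target `stub_K1w_letter := …F0P2pK1wHolds.cmPrincipalSeries_isConstituentOf_weylConj_holds`.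
* §2 **`stubK1w_holds : ‹StubK1wWeylSymmetric›`** — the registered stub K1w BY NAME with ZERO hypotheses (statement = the K1
  sub-line's `StubK1wWeylSymmetric` ∕ ★ `stubK1w_of_weylConj`'s conclusion VERBATIM); one-token fold target `stub_K1w := …F0P2pK1wHolds.stubK1w_holds`.

No new definition, no named fact, no `sorry`; both proofs are single applications (syntactic unification only — the `def` letters are
never unfolded here, cf. the `_proof_k` instance-wall note in ★ `F0P2pK1wLetterOfN1`).
HONEST LABEL: HC_CM is proved only modulo the 2 remaining named inputs (hLiu418, h413) until rung 0 closes; this file proves the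
local statement K1w and nothing about HC_CM by itself.

## References
* [Rogawski1990] J. D. Rogawski, *Automorphic Representations of Unitary Groups in Three Variables*, Ann. of Math. Stud. 123 (1990),
  §12.1 p. 172, §12.2 (2) pp. 173–174.
* [Casselman1995] W. Casselman, *Introduction to the theory of admissible representations of p-adic reductive groups* (1995),
  Lemma 7.1.1 (a), Cor. 7.1.2, Thm. 6.3.5.
* [BernsteinZelevinsky1977] I. N. Bernstein, A. V. Zelevinsky, Ann. Sci. ÉNS 10 (1977), §2.12, Thm. 2.9.
-/

set_option autoImplicit false
-- the mandated namespace has the single-problem summit's repeated segment (`HodgeConjecture.HodgeConjecture`)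
set_option linter.dupNamespace false

noncomputable section

open NumberField IsDedekindDomain MeasureTheory
open scoped NNReal Pointwise

open Literature.NumberTheory Literature.NumberTheory.Automorphic Literature.NumberTheory.Automorphic.UnitaryGroup
open Literature.NumberTheory.Automorphic.IdeleClassGroup
open Literature.NumberTheory.Automorphic.Liu2021 Literature.NumberTheory.Automorphic.Liu2021.Def411WeilCarriers
open Literature.NumberTheory.GaloisRepresentations
open Literature.NumberTheory.Rogawski1990
open Literature.NumberTheory.GelbartRogawski1991
open scoped Matrix

namespace Summit.HodgeConjecture.HodgeConjecture.Cruxes.H413.F0P2pK1wHolds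

/-! ## §1 The K1w letter #98, hypothesis-free -/

/-- **THE K1w LETTER ★ `Rogawski1990.cmPrincipalSeries_isConstituentOf_weylConj`, HYPOTHESIS-FREE**: for the quasi-split
`U(3)(L⁺_v)` at a non-split place `v` of `L⁺` and every character `χ = (χ₁, χ₂)` of the diagonal torus, `i_G(χ)` and `i_G(wχ)`,
`w(χ₁, χ₂) = (χ̄₁⁻¹, χ₂)`, have the same constituents ([Rogawski1990, §12.2 p. 174]; [BernsteinZelevinsky1977, Thm. 2.9]).
Proof: ★ `cmPrincipalSeries_isConstituentOf_weylConj_of_N1` (Casselman's rank-one bookkeeping from the Jacquet filtration N1,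
with N6 a theorem inside) applied to the hypothesis-free N1 — spelled as the body of ★ `U3PrincipalSeriesJacquetFiltration_holds`
(ED. 3, p832625), i.e. ★ `U3PrincipalSeriesJacquetFiltration_holds_of_lineAction L` at (γ-W) ★
`F0P3U3PrincipalSeriesOpenCellTorusChar.torus_normalizedJacquet_openCellLine_eq_weylChar L` ([Casselman1995, Lemma 7.1.1 (a)]),
so that the file elaborates against either edition of the assembly module.  Books: row #98 becomes a theorem of the tree.
[cite: Rogawski1990, §12.2 (2) pp. 173–174]
[cite: Casselman1995, Lemma 7.1.1 (a), Cor. 7.1.2] [cite: BernsteinZelevinsky1977, Thm. 2.9] -/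
theorem cmPrincipalSeries_isConstituentOf_weylConj_holds :
    Literature.NumberTheory.Rogawski1990.cmPrincipalSeries_isConstituentOf_weylConj :=
  F0P2pK1wLetterOfN1.cmPrincipalSeries_isConstituentOf_weylConj_of_N1
    fun L _ _ _ => F0P3U3PrincipalSeriesJacquetFiltrationHolds.U3PrincipalSeriesJacquetFiltration_holds_of_lineAction L
      (F0P3U3PrincipalSeriesOpenCellTorusChar.torus_normalizedJacquet_openCellLine_eq_weylChar L)

/-! ## §2 The registered stub K1w, by name, hypothesis-free -/

set_option synthInstance.maxHeartbeats 400000 in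
set_option maxHeartbeats 8000000 in
/-- **Stub K1w «WEYL SYMMETRY OF THE PRINCIPAL SERIES» of the K1 sub-skeleton `F0_P2GR91NJacquetK1` (registered v2
58d7bd08daa5; statement `StubK1wWeylSymmetric` VERBATIM), HYPOTHESIS-FREE.**  For the K1 data (CM frame, conjugate-symplectic `μ`,
unitary continuous `χ_f`, non-split `v`, form congruence) and every `ψθ`: a constituent of `i_G(χθ^w)`,
`χθ^w = cmXiTorusChar L v (μ_v·‖·‖⁻¹) ψθ⁻¹ ψθ`, is a constituent of `i_G(χθ)`, `χθ = cmXiTorusChar L v μ_v ψθ⁻¹ ψθ`.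
Proof: the consumer ★ `F0P2oK1wOfWeylConj.stubK1w_of_weylConj` (Weyl flip `((χ₁θʷ) ∘ σ)⁻¹ = χ₁θ` for conjugate-symplectic `μ`)
at the hypothesis-free letter (§1). [cite: Rogawski1990, §12.1 p. 172, §12.2 (2) p. 174] [cite: Casselman1995, Lemma 7.1.1 (a)] -/
theorem stubK1w_holds :
  ∀ (L : Type) [Field L] [NumberField L] [IsCMField L] (H : Matrix (Fin 3) (Fin 3) L) (hH : (H.map (cmConjRingHom L))ᵀ = H) (hHd : IsUnit H.det)
    {n' : ℕ} (e₁ : Fin 3 × Fin 1 ≃ Fin n') (dV : Fin 3 → L) (hdV : ∀ i, IsCMField.complexConj L (dV i) = dV i) (hdV0 : ∀ i, dV i ≠ 0) (g : GL (Fin 3) L)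
    (hg : ((g : Matrix (Fin 3) (Fin 3) L).map (cmConjRingHom L))ᵀ * H * (g : Matrix (Fin 3) (Fin 3) L) = Matrix.diagonal dV),
    ∀ (μ : Literature.NumberTheory.Automorphic.IdeleClassGroup L →ₜ* Circle) (hμ : IsConjugateSymplectic L μ)
      (χf : UnitaryGroup.finAdelicOne (↥(maximalRealSubfield L)) L (IsCMField.complexConj L) →* ℂˣ),
      Continuous χf → (∀ z, ‖((χf z : ℂˣ) : ℂ)‖ = 1) →
      ∀ (v : HeightOneSpectrum (𝓞 ↥(maximalRealSubfield L))),
        (∀ w : PlacesOver L v, IsCMField.complexConj L • w.1 = w.1) →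
        ∀ (T : GL (Fin 3) (UnitaryGroup.LocalRing L v)) (a : UnitaryGroup.LocalRing L v) (ha : IsUnit a)
          (h : formCongr (conjLocal L (IsCMField.complexConj L) v) T (H.map (algebraMap L (UnitaryGroup.LocalRing L v))) =
            a • (Matrix.of fun i j : Fin 3 => if i.val + j.val + 1 = 3 then (1 : L) else 0).map (algebraMap L (UnitaryGroup.LocalRing L v))),
          ∀ (ψθ : ↥(normOneUnits (conjLocal L (IsCMField.complexConj L) v)) →* ℂˣ) (c : IrrClass (Gqs L v)),
            c.IsConstituentOf (cmPrincipalSeries L 3 v (cmXiTorusChar L v ((toHeckeCharacter L μ).semilocalComponent L v * ((halfModulusChar (UnitaryGroup.LocalRing L v)) ^ 2)⁻¹) ψθ⁻¹ ψθ)) →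
            c.IsConstituentOf (cmPrincipalSeries L 3 v (cmXiTorusChar L v ((toHeckeCharacter L μ).semilocalComponent L v) ψθ⁻¹ ψθ)) :=
  F0P2oK1wOfWeylConj.stubK1w_of_weylConj cmPrincipalSeries_isConstituentOf_weylConj_holds

end Summit.HodgeConjecture.HodgeConjecture.Cruxes.H413.F0P2pK1wHolds

end
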